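import Summits.QuantumFields.YangMills.Theses.BalabanLadder
import Summits.QuantumFields.YangMills.Theses.BalabanFamilyExport
import Summits.QuantumFields.YangMills.Theses.BalabanFluctuationExport
import Summits.QuantumFields.YangMills.Theorems.BalabanLadderUVTorusClassDefs
import Summits.QuantumFields.YangMills.Theorems.BalabanLadderUVTorusDictionary
import Literature.MathematicalPhysics.QuantumFieldTheory.Balaban1983to89.BlockAveragingSU2
import HarnessLib

/-!
# Line `response_regime_split` — regime decomposition of the conditional RESPONSE, typed around the global-mean coupling
(D-0145 ideator ym-idea-9 g2, LINE 6, lens «complete»)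

Skeleton for the crux `Summit.QuantumFields.YangMills.Theses.BalabanLadder.UVSeamRec` (stmt-QuantumFields-20043), realised as the
split of `BalabanFluctuationExport.CondResponse` (26018) into `RoughFieldResponse` (26652, ∃δ: a version within `C/b⁴` of the torus mean ON
ROUGH block fields — the pointwise energy-spreading principle for one insertion, hardest), `SmallFieldOscillation` (26653, ∀δ: the OSCILLATION
of a version over δ-small block fields is `≤ C/b⁴` — mean-free, printed background-field territory) and `SmallFieldsTypical` (26654, ∀δ:
Wilson probability of the δ-small event `≥ 1/2` in the UV window).  The point of the typing: a sup-bound relative to the GLOBAL mean `m` does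
not split naively by regime (the small half would inherit the rough fields through `m`; rough block fields at fixed physical size are not
rare as `b → ∞`), so the small-field piece compares small backgrounds with each other and the link to `m` is recovered in the PROVED glue
`condResponse_of_split` (patch the versions along the measurable event; `μ(s)(g₁ W₀ − m) = ∫χ_s∘Q(g₁ W₀ − g₁∘Q) + ∫χ_s∘Q(p − m)`, the
latter `= −∫χ_r∘Q(g₂∘Q − m)` because `∫ p dμ = m` is the definition of `torusEOn`; divide by `μ(s) ≥ 1/2`).  The seven registered stubs are
route items BY NAME (`CondDecoupling` is kept whole here; its own split is the sibling line `field_regime_split`); `UVSeamRec_of` concludes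
the crux by name through `BalabanFluctuationExport.closes`.  No summit, leg or spine crux is proved here; sorries live only inside `stub_*`.
-/

set_option autoImplicit false

namespace Summit.QuantumFields.YangMills.Cruxes.UVSeamRec.ResponseRegimeSplit

open MeasureTheory
open Literature.MathematicalPhysics.QuantumFieldTheory
open Literature.MathematicalPhysics.QuantumFieldTheory.Balaban1983to89
open Literature.MathematicalPhysics.QuantumFieldTheory.Balaban1983to89.T4Continuum
open Literature.MathematicalPhysics.QuantumLattice (LGConfig torusLift fundamentalLatticeRep)
open Summit.QuantumFields.YangMills.Cruxes.OSLegsFromFemtoAndGap.DlrCollarTransfer (plane)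
open Summit.QuantumFields.YangMills.Cruxes.UV.TorusClass (torusEOn MomentBounds6OnSides)
open Summit.QuantumFields.YangMills.Theses.BalabanFluctuationExport

/-- stub (route item 26652, crux, hardest): conditional response within `C/b⁴` of the torus mean on ROUGH block fields, some δ ∈ (0,1]. -/
theorem stub_roughFieldResponse : RoughFieldResponse := by
  sorry

/-- stub (route item 26653, crux): oscillation of the conditional response over δ-SMALL block fields `≤ C/b⁴`, every δ ∈ (0,1]. -/
theorem stub_smallFieldOscillation : SmallFieldOscillation := by
  sorry

/-- stub (route item 26654, crux): δ-small block fields near any block have Wilson probability `≥ 1/2` in the UV window, every δ. -/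
theorem stub_smallFieldsTypical : SmallFieldsTypical := by
  sorry

/-- stub (route item 26017, crux of the parent route; split separately by the sibling line `field_regime_split`): conditional decoupling. -/
theorem stub_condDecoupling : CondDecoupling := by
  sorry

/-- stub (route item 26019, support/glue of the parent route): martingale telescoping to the family ceilings. -/
theorem stub_fluctuationExportGlue : FluctuationExportGlue := by
  sorry

/-- stub (route item 25033, crux): the family seam (thermodynamic transfer + odd finite-volume ceilings). -/
theorem stub_familySeam : FamilySeam := by
  sorry

/-- stub (route item 25034, crux): the floors engine. -/
theorem stub_floorsEngine : FloorsEngine := by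
  sorry

/-! ## Measurability of the block-average map and of the single-block small-field event (as in LINE 5's `smallEventMeasurable_holds`). -/

theorem measurable_blockField (F : T4Family) (K k : ℕ) :
    letI : MeasurableSpace (Matrix.specialUnitaryGroup (Fin 2) ℂ) := borel _
    Measurable (fun V : GaugeConfig 4 ((F.P K).sitesPerDir 0) (Matrix.specialUnitaryGroup (Fin 2) ℂ) =>
      Averaging.iter (fun j => BlockAveraging.blockAvg (P := F.P K) (j := j) su2Mean) k (ofConfig (P := F.P K) (j := 0) V)) := by
  letI : MeasurableSpace (Matrix.specialUnitaryGroup (Fin 2) ℂ) := borel _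
  haveI : BorelSpace (Matrix.specialUnitaryGroup (Fin 2) ℂ) := ⟨rfl⟩
  have hav : ∀ j, Measurable (fun U : GaugeField (F.P K) j (Matrix.specialUnitaryGroup (Fin 2) ℂ) =>
      (BlockAveraging.blockAvg (P := F.P K) (j := j) su2Mean).avg U) :=
    fun j => BlockAveraging.measurable_avgFun (P := F.P K) (j := j) su2Mean measurable_su2Mean_E
  have hiter : ∀ k', Measurable (Averaging.iter (P := F.P K) (G := Matrix.specialUnitaryGroup (Fin 2) ℂ)
      (fun j => BlockAveraging.blockAvg (P := F.P K) (j := j) su2Mean) k') := by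
    intro k'
    induction k' with
    | zero => exact measurable_id
    | succ k' ih => exact (hav k').comp ih
  have hof : Measurable (fun V : GaugeConfig 4 ((F.P K).sitesPerDir 0) (Matrix.specialUnitaryGroup (Fin 2) ℂ) =>
      ofConfig (P := F.P K) (j := 0) V) :=
    measurable_pi_lambda _ fun b => measurable_pi_apply _
  exact (hiter k).comp hof

theorem measurableSet_plaqSmallOn (F : T4Family) (K k : ℕ) (S : Set (Plaq (F.P K) k)) (δ : ℝ) :
    letI : MeasurableSpace (Matrix.specialUnitaryGroup (Fin 2) ℂ) := borel _
    MeasurableSet {W : GaugeField (F.P K) k (Matrix.specialUnitaryGroup (Fin 2) ℂ) | PlaqSmallOn S δ W} := by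
  letI : MeasurableSpace (Matrix.specialUnitaryGroup (Fin 2) ℂ) := borel _
  haveI : BorelSpace (Matrix.specialUnitaryGroup (Fin 2) ℂ) := ⟨rfl⟩
  have hpl : ∀ pl : Plaq (F.P K) k, Measurable (fun W : GaugeField (F.P K) k (Matrix.specialUnitaryGroup (Fin 2) ℂ) =>
      dist1 (GaugeField.plaqHol W pl)) := fun pl => by
    have hb : ∀ b : PBond (F.P K) k, Continuous fun U : (PBond (F.P K) k → Matrix.specialUnitaryGroup (Fin 2) ℂ) => U b :=
      fun b => continuous_apply b
    have hc : Continuous fun U : (PBond (F.P K) k → Matrix.specialUnitaryGroup (Fin 2) ℂ) =>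
        GaugeField.plaqHol (P := F.P K) (j := k) U pl := by
      unfold GaugeField.plaqHol
      exact (((hb _).mul (hb _)).mul (hb _).inv).mul (hb _).inv
    have hm : Measurable fun U : (PBond (F.P K) k → Matrix.specialUnitaryGroup (Fin 2) ℂ) =>
        dist1 (GaugeField.plaqHol (P := F.P K) (j := k) U pl) :=
      RegularGaugeGroup.measurable_dist1.comp hc.measurable
    exact hm
  have : {W : GaugeField (F.P K) k (Matrix.specialUnitaryGroup (Fin 2) ℂ) | PlaqSmallOn S δ W}
      = ⋂ pl ∈ S, {W | dist1 (GaugeField.plaqHol W pl) < δ} := by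
    ext W; simp only [PlaqSmallOn, Set.mem_setOf_eq, Set.mem_iInter]
  rw [this]
  exact MeasurableSet.biInter (Set.to_countable _) fun pl _ => measurableSet_lt (hpl pl) measurable_const

/-- The parent crux `CondResponse` (item 26018) with its `let`s expanded (definitionally equal to the route decl: `condResponseX_iff` below). -/
def CondResponseX : Prop :=
  letI : MeasurableSpace (Matrix.specialUnitaryGroup (Fin 2) ℂ) := borel _
  haveI : BorelSpace (Matrix.specialUnitaryGroup (Fin 2) ℂ) := ⟨rfl⟩
  ∀ L : ℕ, Odd L → 11 < L →
  ∃ (C β₄ ℓ₄ : ℝ), 0 < ℓ₄ ∧ 0 ≤ C ∧ ∀ β : ℝ, β₄ ≤ β →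
    ∀ (F : T4Family) (K k : ℕ), F.L = L → k + 1 ≤ F.m + K →
      ((L : ℝ) ^ k) * Summit.QuantumFields.YangMills.Cruxes.UVSeamRec.Transport.uRec β ≤ ℓ₄ →
      ∀ (q : Fin 4 × Fin 4) (x : Fin 4 → ℤ), q.1 < q.2 →
        haveI : NeZero ((F.P K).sitesPerDir 0) := ⟨Params.sitesPerDir_ne_zero _ _⟩
        ∃ g : GaugeField (F.P K) k (Matrix.specialUnitaryGroup (Fin 2) ℂ) → ℝ,
          Measurable (fun V : GaugeConfig 4 ((F.P K).sitesPerDir 0) (Matrix.specialUnitaryGroup (Fin 2) ℂ) =>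
              g (Averaging.iter (fun j => BlockAveraging.blockAvg (P := F.P K) (j := j) su2Mean) k
                (ofConfig (P := F.P K) (j := 0) V))) ∧
          (∀ W, |g W - torusEOn (Matrix.specialUnitaryGroup (Fin 2) ℂ) (fundamentalLatticeRep 2) β ((F.P K).sitesPerDir 0)
              (plane (Matrix.specialUnitaryGroup (Fin 2) ℂ) (fundamentalLatticeRep 2) q x)| ≤ C / ((L : ℝ) ^ k) ^ 4) ∧
          ∀ φ : GaugeField (F.P K) k (Matrix.specialUnitaryGroup (Fin 2) ℂ) → ℝ,
            Measurable (fun V : GaugeConfig 4 ((F.P K).sitesPerDir 0) (Matrix.specialUnitaryGroup (Fin 2) ℂ) =>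
              φ (Averaging.iter (fun j => BlockAveraging.blockAvg (P := F.P K) (j := j) su2Mean) k
                (ofConfig (P := F.P K) (j := 0) V))) →
            (∀ W, |φ W| ≤ 1) →
            ∫ V, (plane (Matrix.specialUnitaryGroup (Fin 2) ℂ) (fundamentalLatticeRep 2) q x
                    (torusLift ((F.P K).sitesPerDir 0) V)
                  - g (Averaging.iter (fun j => BlockAveraging.blockAvg (P := F.P K) (j := j) su2Mean) k
                      (ofConfig (P := F.P K) (j := 0) V)))
                * φ (Averaging.iter (fun j => BlockAveraging.blockAvg (P := F.P K) (j := j) su2Mean) k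
                      (ofConfig (P := F.P K) (j := 0) V))
              ∂(wilsonMeasure (d := 4) (L := (F.P K).sitesPerDir 0) (fundamentalLatticeRep 2).ρ β) = 0

/-! ## The glue — PROVED (over `CondResponseX`, the `let`-expanded parent; coerced to the route decls below). -/

attribute [local instance] Classical.propDecidable in
theorem condResponse_of_splitX :
    SmallFieldOscillation → RoughFieldResponse → SmallFieldsTypical → CondResponseX := by
  intro hS hR hT
  letI : MeasurableSpace (Matrix.specialUnitaryGroup (Fin 2) ℂ) := borel _
  haveI : BorelSpace (Matrix.specialUnitaryGroup (Fin 2) ℂ) := ⟨rfl⟩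
  intro L hLo hL11
  obtain ⟨δ, hδ0, hδ1, C₂, β₂, ℓ₂, hℓ₂, hC₂, hRough⟩ := hR L hLo hL11
  obtain ⟨C₁, β₁, ℓ₁, hℓ₁, hC₁, hSmall⟩ := hS L hLo hL11 δ hδ0 hδ1
  obtain ⟨β₃, ℓ₃, hℓ₃, hTyp⟩ := hT L hLo hL11 δ hδ0 hδ1
  refine ⟨C₁ + 2 * C₂, max (max β₁ β₂) β₃, min (min ℓ₁ ℓ₂) ℓ₃, lt_min (lt_min hℓ₁ hℓ₂) hℓ₃, by positivity, ?_⟩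
  intro β hβ F K k hFL hk hb q x hq
  haveI : NeZero ((F.P K).sitesPerDir 0) := ⟨Params.sitesPerDir_ne_zero _ _⟩
  have hβ₁ : β₁ ≤ β := ((le_max_left _ _).trans (le_max_left _ _)).trans hβ
  have hβ₂ : β₂ ≤ β := ((le_max_right _ _).trans (le_max_left _ _)).trans hβ
  have hβ₃ : β₃ ≤ β := (le_max_right _ _).trans hβ
  have hb₁ : ((L : ℝ) ^ k) * Summit.QuantumFields.YangMills.Cruxes.UVSeamRec.Transport.uRec β ≤ ℓ₁ :=
    hb.trans ((min_le_left _ _).trans (min_le_left _ _))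
  have hb₂ : ((L : ℝ) ^ k) * Summit.QuantumFields.YangMills.Cruxes.UVSeamRec.Transport.uRec β ≤ ℓ₂ :=
    hb.trans ((min_le_left _ _).trans (min_le_right _ _))
  have hb₃ : ((L : ℝ) ^ k) * Summit.QuantumFields.YangMills.Cruxes.UVSeamRec.Transport.uRec β ≤ ℓ₃ := hb.trans (min_le_right _ _)
  set M : ℕ := (F.P K).sitesPerDir 0 with hMdef
  set Q : GaugeConfig 4 M (Matrix.specialUnitaryGroup (Fin 2) ℂ) →
      GaugeField (F.P K) k (Matrix.specialUnitaryGroup (Fin 2) ℂ) :=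
    fun V => Averaging.iter (fun j => BlockAveraging.blockAvg (P := F.P K) (j := j) su2Mean) k
      (ofConfig (P := F.P K) (j := 0) V) with hQdef
  set μ : Measure (GaugeConfig 4 M (Matrix.specialUnitaryGroup (Fin 2) ℂ)) :=
    wilsonMeasure (d := 4) (L := M) (fundamentalLatticeRep 2).ρ β with hμdef
  set pV : GaugeConfig 4 M (Matrix.specialUnitaryGroup (Fin 2) ℂ) → ℝ :=
    fun V => plane (Matrix.specialUnitaryGroup (Fin 2) ℂ) (fundamentalLatticeRep 2) q x (torusLift M V) with hpVdef
  set m : ℝ := torusEOn (Matrix.specialUnitaryGroup (Fin 2) ℂ) (fundamentalLatticeRep 2) β M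
    (plane (Matrix.specialUnitaryGroup (Fin 2) ℂ) (fundamentalLatticeRep 2) q x) with hmdef
  let c : Site (F.P K) k :=
    fun ν => (((((x ν : ℤ) : ZMod ((F.P K).sitesPerDir 0))).val / F.L ^ k : ℕ) : ZMod ((F.P K).sitesPerDir k))
  let Sm : GaugeField (F.P K) k (Matrix.specialUnitaryGroup (Fin 2) ℂ) → Prop :=
    fun W => PlaqSmallOn {pl : Plaq (F.P K) k | Site.tdist pl.src c ≤ 2} δ W
  -- the three inputs at this family member
  obtain ⟨g₁, hg₁m, ⟨D₁, hD₁⟩, hg₁osc, hg₁o⟩ := hSmall β hβ₁ F K k hFL hk hb₁ q x hq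
  obtain ⟨g₂, hg₂m, ⟨D₂, hD₂⟩, hg₂b, hg₂o⟩ := hRough β hβ₂ F K k hFL hk hb₂ q x hq
  have htyp : (1 / 2 : ℝ) ≤ (μ {V | Sm (Q V)}).toReal := hTyp β hβ₃ F K k hFL hk hb₃ x
  -- measurability of the event
  have hQm : Measurable Q := measurable_blockField F K k
  have hSm : MeasurableSet {V : GaugeConfig 4 M (Matrix.specialUnitaryGroup (Fin 2) ℂ) | Sm (Q V)} :=
    hQm (measurableSet_plaqSmallOn F K k {pl : Plaq (F.P K) k | Site.tdist pl.src c ≤ 2} δ)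
  -- probability measure, bounded plane observable
  haveI : IsProbabilityMeasure μ :=
    isProbabilityMeasure_wilsonMeasure (d := 4) (L := M) (fundamentalLatticeRep 2).ρ (fundamentalLatticeRep 2).continuous β
  obtain ⟨B, hB⟩ := Summit.QuantumFields.YangMills.Cruxes.OSLegsFromFemtoAndGap.DlrCollarTransfer.exists_abs_plane_le
    (G := Matrix.specialUnitaryGroup (Fin 2) ℂ) (fundamentalLatticeRep 2)
  have hpVm : Measurable pV :=
    (Summit.QuantumFields.YangMills.Cruxes.OSLegsFromFemtoAndGap.DlrCollarTransfer.continuous_plane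
      (G := Matrix.specialUnitaryGroup (Fin 2) ℂ) (fundamentalLatticeRep 2) q x).measurable.comp
      (measurable_torusLift (d := 4) (G := Matrix.specialUnitaryGroup (Fin 2) ℂ) M)
  have hpVb : ∀ V, |pV V| ≤ B := fun V => hB q x _
  -- generic integrability of bounded measurable functions on the probability space
  have hint : ∀ (f : GaugeConfig 4 M (Matrix.specialUnitaryGroup (Fin 2) ℂ) → ℝ) (A : ℝ),
      Measurable f → (∀ V, |f V| ≤ A) → Integrable f μ := fun f A hfm hfb =>
    Integrable.mono' (integrable_const A) hfm.aestronglyMeasurable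
      (Filter.Eventually.of_forall fun V => by rw [Real.norm_eq_abs]; exact hfb V)
  -- indicator test functions of the two regimes
  let χs : GaugeField (F.P K) k (Matrix.specialUnitaryGroup (Fin 2) ℂ) → ℝ := fun W => if Sm W then 1 else 0
  let χr : GaugeField (F.P K) k (Matrix.specialUnitaryGroup (Fin 2) ℂ) → ℝ := fun W => if Sm W then 0 else 1
  have hχsm : Measurable (fun V => χs (Q V)) := Measurable.ite hSm measurable_const measurable_const
  have hχrm : Measurable (fun V => χr (Q V)) := Measurable.ite hSm measurable_const measurable_const
  have hχsb : ∀ W, |χs W| ≤ 1 := fun W => by by_cases h : Sm W <;> simp [χs, h]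
  have hχrb : ∀ W, |χr W| ≤ 1 := fun W => by by_cases h : Sm W <;> simp [χr, h]
  have hχs01 : ∀ W, 0 ≤ χs W ∧ χs W ≤ 1 := fun W => by by_cases h : Sm W <;> simp [χs, h]
  have hχr01 : ∀ W, 0 ≤ χr W ∧ χr W ≤ 1 := fun W => by by_cases h : Sm W <;> simp [χr, h]
  -- integrability of the regime-weighted centred observables
  have hPs_int : Integrable (fun V => χs (Q V) * (pV V - m)) μ :=
    hint (fun V => χs (Q V) * (pV V - m)) (1 * (B + |m|)) (hχsm.mul (hpVm.sub measurable_const)) fun V => by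
      rw [abs_mul]; exact mul_le_mul (hχsb _) ((abs_sub _ _).trans (add_le_add (hpVb _) le_rfl)) (abs_nonneg _) zero_le_one
  have hPr_int : Integrable (fun V => χr (Q V) * (pV V - m)) μ :=
    hint (fun V => χr (Q V) * (pV V - m)) (1 * (B + |m|)) (hχrm.mul (hpVm.sub measurable_const)) fun V => by
      rw [abs_mul]; exact mul_le_mul (hχrb _) ((abs_sub _ _).trans (add_le_add (hpVb _) le_rfl)) (abs_nonneg _) zero_le_one
  have hBr_int : Integrable (fun V => χr (Q V) * (g₂ (Q V) - m)) μ :=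
    hint (fun V => χr (Q V) * (g₂ (Q V) - m)) (1 * (D₂ + |m|)) (hχrm.mul (hg₂m.sub measurable_const)) fun V => by
      rw [abs_mul]; exact mul_le_mul (hχrb _) ((abs_sub _ _).trans (add_le_add (hD₂ _) le_rfl)) (abs_nonneg _) zero_le_one
  -- ∫ χs∘Q = μ(s).toReal ≥ 1/2
  have hχs_int : ∫ V, χs (Q V) ∂μ = (μ {V | Sm (Q V)}).toReal := by
    have : (fun V => χs (Q V)) = Set.indicator {V | Sm (Q V)} (fun _ => (1 : ℝ)) := by
      funext V; by_cases h : Sm (Q V) <;> simp [χs, h, Set.indicator]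
    rw [this, integral_indicator_const (1 : ℝ) hSm]
    simp [Measure.real]
  have hμs : (1 / 2 : ℝ) ≤ ∫ V, χs (Q V) ∂μ := hχs_int ▸ htyp
  -- the mean identity ∫ p dμ = m (definition of `torusEOn`) and ∫ (p − m) = 0
  have hmean : ∫ V, pV V ∂μ = m := by simp [hpVdef, hmdef, torusEOn, hμdef]
  have hcent : ∫ V, (pV V - m) ∂μ = 0 := by
    rw [integral_sub (hint pV B hpVm hpVb) (integrable_const m), hmean]
    simp
  -- the patched version
  let g : GaugeField (F.P K) k (Matrix.specialUnitaryGroup (Fin 2) ℂ) → ℝ := fun W => if Sm W then g₁ W else g₂ W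
  have hgm : Measurable (fun V => g (Q V)) := Measurable.ite hSm hg₁m hg₂m
  have hLpos : (0 : ℝ) < ((L : ℝ) ^ k) ^ 4 := by positivity
  -- KEY ESTIMATE on a small block field W₀: |g₁ W₀ − m| ≤ (C₁ + 2 C₂)/b⁴
  have hsmall : ∀ W₀, Sm W₀ → |g₁ W₀ - m| ≤ (C₁ + 2 * C₂) / ((L : ℝ) ^ k) ^ 4 := by
    intro W₀ hW₀
    -- A := ∫ χs∘Q · (g₁ W₀ − g₁∘Q),  B := ∫ χs∘Q · (g₁∘Q − m)
    have hA_int : Integrable (fun V => χs (Q V) * (g₁ W₀ - g₁ (Q V))) μ :=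
      hint _ (1 * (|g₁ W₀| + D₁)) (hχsm.mul (measurable_const.sub hg₁m)) fun V => by
        rw [abs_mul]; exact mul_le_mul (hχsb _) ((abs_sub _ _).trans (add_le_add le_rfl (hD₁ _))) (abs_nonneg _) zero_le_one
    have hB_int : Integrable (fun V => χs (Q V) * (g₁ (Q V) - m)) μ :=
      hint _ (1 * (D₁ + |m|)) (hχsm.mul (hg₁m.sub measurable_const)) fun V => by
        rw [abs_mul]; exact mul_le_mul (hχsb _) ((abs_sub _ _).trans (add_le_add (hD₁ _) le_rfl)) (abs_nonneg _) zero_le_one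
    have hsum : (g₁ W₀ - m) * ∫ V, χs (Q V) ∂μ
        = (∫ V, χs (Q V) * (g₁ W₀ - g₁ (Q V)) ∂μ) + ∫ V, χs (Q V) * (g₁ (Q V) - m) ∂μ := by
      rw [← integral_add hA_int hB_int, ← integral_const_mul]
      refine integral_congr_ae (Filter.Eventually.of_forall fun V => ?_)
      simp only; ring
    -- |A| ≤ (C₁/b⁴) ∫ χs∘Q
    have hA : |∫ V, χs (Q V) * (g₁ W₀ - g₁ (Q V)) ∂μ| ≤ (C₁ / ((L : ℝ) ^ k) ^ 4) * ∫ V, χs (Q V) ∂μ := by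
      rw [← integral_const_mul]
      refine (abs_integral_le_integral_abs).trans (integral_mono (hA_int.abs) ((hint (fun V => χs (Q V)) 1 hχsm fun V => hχsb _).const_mul _) fun V => ?_)
      simp only
      by_cases h : Sm (Q V)
      · rw [abs_mul]; simp only [χs, if_pos h, abs_one, one_mul, mul_one]; exact hg₁osc W₀ (Q V) hW₀ h
      · simp [χs, h]
    -- B = ∫ χs∘Q (p − m) = −∫ χr∘Q (p − m) = −∫ χr∘Q (g₂∘Q − m)
    have hB1 : ∫ V, χs (Q V) * (g₁ (Q V) - m) ∂μ = ∫ V, χs (Q V) * (pV V - m) ∂μ := by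
      have h0 : ∫ V, (pV V - g₁ (Q V)) * χs (Q V) ∂μ = 0 := hg₁o χs hχsm hχsb
      have h1 : ∫ V, χs (Q V) * (pV V - m) ∂μ - ∫ V, χs (Q V) * (g₁ (Q V) - m) ∂μ = 0 := by
        rw [← integral_sub hPs_int hB_int, ← h0]
        refine integral_congr_ae (Filter.Eventually.of_forall fun V => ?_); simp only; ring
      linarith
    have hB2 : ∫ V, χs (Q V) * (pV V - m) ∂μ = - ∫ V, χr (Q V) * (pV V - m) ∂μ := by
      have hsplit : ∫ V, χs (Q V) * (pV V - m) ∂μ + ∫ V, χr (Q V) * (pV V - m) ∂μ = ∫ V, (pV V - m) ∂μ := by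
        rw [← integral_add hPs_int hPr_int]
        refine integral_congr_ae (Filter.Eventually.of_forall fun V => ?_)
        by_cases h : Sm (Q V) <;> simp [χs, χr, h]
      linarith [hcent]
    have hB3 : ∫ V, χr (Q V) * (pV V - m) ∂μ = ∫ V, χr (Q V) * (g₂ (Q V) - m) ∂μ := by
      have h0 : ∫ V, (pV V - g₂ (Q V)) * χr (Q V) ∂μ = 0 := hg₂o χr hχrm hχrb
      have h1 : ∫ V, χr (Q V) * (pV V - m) ∂μ - ∫ V, χr (Q V) * (g₂ (Q V) - m) ∂μ = 0 := by
        rw [← integral_sub hPr_int hBr_int, ← h0]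
        refine integral_congr_ae (Filter.Eventually.of_forall fun V => ?_); simp only; ring
      linarith
    have hB : |∫ V, χs (Q V) * (g₁ (Q V) - m) ∂μ| ≤ C₂ / ((L : ℝ) ^ k) ^ 4 := by
      rw [hB1, hB2, hB3, abs_neg]
      calc |∫ V, χr (Q V) * (g₂ (Q V) - m) ∂μ|
          ≤ ∫ V, |χr (Q V) * (g₂ (Q V) - m)| ∂μ := abs_integral_le_integral_abs
        _ ≤ ∫ V, (C₂ / ((L : ℝ) ^ k) ^ 4) ∂μ := by
            refine integral_mono hBr_int.abs (integrable_const _) fun V => ?_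
            simp only
            by_cases h : Sm (Q V)
            · simp only [χr, if_pos h, zero_mul, abs_zero]; exact div_nonneg hC₂ hLpos.le
            · rw [abs_mul]; simp only [χr, if_neg h, abs_one, one_mul]; exact hg₂b (Q V) h
        _ = C₂ / ((L : ℝ) ^ k) ^ 4 := by simp
    -- combine: |g₁ W₀ − m| · ∫χs ≤ (C₁/b⁴) ∫χs + C₂/b⁴, and ∫χs ≥ 1/2
    have hI0 : (1 / 2 : ℝ) ≤ ∫ V, χs (Q V) ∂μ := hμs
    have hkey : |g₁ W₀ - m| * ∫ V, χs (Q V) ∂μ ≤ (C₁ / ((L : ℝ) ^ k) ^ 4) * ∫ V, χs (Q V) ∂μ + C₂ / ((L : ℝ) ^ k) ^ 4 := by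
      have : |(g₁ W₀ - m) * ∫ V, χs (Q V) ∂μ| ≤ _ := (congrArg abs hsum).le.trans ((abs_add_le _ _).trans (add_le_add hA hB))
      rwa [abs_mul, abs_of_nonneg (le_trans (by norm_num) hI0)] at this
    have hC₁' : 0 ≤ C₁ / ((L : ℝ) ^ k) ^ 4 := div_nonneg hC₁ hLpos.le
    have hC₂' : 0 ≤ C₂ / ((L : ℝ) ^ k) ^ 4 := div_nonneg hC₂ hLpos.le
    rw [add_div, mul_div_assoc]
    nlinarith [abs_nonneg (g₁ W₀ - m), hI0, hkey, hC₁', hC₂']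
  refine ⟨g, hgm, ?_, ?_⟩
  · -- the bound everywhere
    intro W
    by_cases h : Sm W
    · simp only [g, if_pos h]; exact hsmall W h
    · simp only [g, if_neg h]
      refine (hg₂b W h).trans (div_le_div_of_nonneg_right ?_ hLpos.le)
      linarith
  · -- orthogonality of the patched version
    intro φ hφm hφb
    let φs : GaugeField (F.P K) k (Matrix.specialUnitaryGroup (Fin 2) ℂ) → ℝ := fun W => if Sm W then φ W else 0
    let φr : GaugeField (F.P K) k (Matrix.specialUnitaryGroup (Fin 2) ℂ) → ℝ := fun W => if Sm W then 0 else φ W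
    have hφsm : Measurable (fun V => φs (Q V)) := Measurable.ite hSm hφm measurable_const
    have hφrm : Measurable (fun V => φr (Q V)) := Measurable.ite hSm measurable_const hφm
    have hφsb : ∀ W, |φs W| ≤ 1 := fun W => by by_cases h : Sm W <;> simp [φs, h, hφb W]
    have hφrb : ∀ W, |φr W| ≤ 1 := fun W => by by_cases h : Sm W <;> simp [φr, h, hφb W]
    have h1 : ∫ V, (pV V - g₁ (Q V)) * φs (Q V) ∂μ = 0 := hg₁o φs hφsm hφsb
    have h2 : ∫ V, (pV V - g₂ (Q V)) * φr (Q V) ∂μ = 0 := hg₂o φr hφrm hφrb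
    have hint2 : ∀ (gg : GaugeField (F.P K) k (Matrix.specialUnitaryGroup (Fin 2) ℂ) → ℝ) (D : ℝ), (∀ W, |gg W| ≤ D) →
        Measurable (fun V => gg (Q V)) → ∀ χ : GaugeField (F.P K) k (Matrix.specialUnitaryGroup (Fin 2) ℂ) → ℝ,
        Measurable (fun V => χ (Q V)) → (∀ W, |χ W| ≤ 1) →
        Integrable (fun V => (pV V - gg (Q V)) * χ (Q V)) μ := fun gg D hD hggm χ hχm hχb =>
      hint _ ((B + D) * 1) ((hpVm.sub hggm).mul hχm) fun V => by
        rw [abs_mul]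
        have h1 : |pV V - gg (Q V)| ≤ B + D := (abs_sub _ _).trans (add_le_add (hpVb _) (hD _))
        exact mul_le_mul h1 (hχb _) (abs_nonneg _) ((abs_nonneg _).trans h1)
    have hsplit : ∀ V, (pV V - g (Q V)) * φ (Q V) = (pV V - g₁ (Q V)) * φs (Q V) + (pV V - g₂ (Q V)) * φr (Q V) := fun V => by
      by_cases h : Sm (Q V) <;> simp [g, φs, φr, h]
    show ∫ V, (pV V - g (Q V)) * φ (Q V) ∂μ = 0
    calc ∫ V, (pV V - g (Q V)) * φ (Q V) ∂μ
        = ∫ V, ((pV V - g₁ (Q V)) * φs (Q V) + (pV V - g₂ (Q V)) * φr (Q V)) ∂μ :=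
          integral_congr_ae (Filter.Eventually.of_forall hsplit)
      _ = ∫ V, (pV V - g₁ (Q V)) * φs (Q V) ∂μ + ∫ V, (pV V - g₂ (Q V)) * φr (Q V) ∂μ :=
          integral_add (hint2 g₁ D₁ hD₁ hg₁m φs hφsm hφsb) (hint2 g₂ D₂ hD₂ hg₂m φr hφrm hφrb)
      _ = 0 := by rw [h1, h2, add_zero]


/-- `CondResponseX` is the route decl `CondResponse` with its `let`s expanded. -/
theorem condResponseX_iff : CondResponseX ↔ CondResponse := Iff.rfl

/-- The glue of the split over the ROUTE decls, in the gate's order (item 26655 `CondResponseGlue`). -/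
theorem condResponse_of_split :
    RoughFieldResponse → SmallFieldOscillation → SmallFieldsTypical → CondResponse :=
  fun hR hS hT => condResponseX_iff.mp (condResponse_of_splitX hS hR hT)

/-- … and it is literally the route's glue item. -/
theorem condResponseGlue_holds : CondResponseGlue := condResponse_of_split

/-- The composition: the seven stubs give the spine crux BY NAME (kernel-checked, no sorry outside the stubs). -/
theorem UVSeamRec_of :
    RoughFieldResponse → SmallFieldOscillation → SmallFieldsTypical → CondDecoupling → FluctuationExportGlue →
      FamilySeam → FloorsEngine → Summit.QuantumFields.YangMills.Theses.BalabanLadder.UVSeamRec :=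
  fun hR hS hT h₂ h₃ h₄ h₅ =>
    Summit.QuantumFields.YangMills.Theses.BalabanFluctuationExport.closes (condResponse_of_split hR hS hT) h₂ h₃ h₄ h₅

theorem UVSeamRec_holds_of_stubs : Summit.QuantumFields.YangMills.Theses.BalabanLadder.UVSeamRec :=
  UVSeamRec_of stub_roughFieldResponse stub_smallFieldOscillation stub_smallFieldsTypical stub_condDecoupling
    stub_fluctuationExportGlue stub_familySeam stub_floorsEngine

end Summit.QuantumFields.YangMills.Cruxes.UVSeamRec.ResponseRegimeSplit
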